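import Literature.NumberTheory.Transcendental.RoySmallValueLinearFactors
import HarnessLib

/-!
# Roy's small value estimate for `𝔾ₐ × 𝔾ₘ` — heights of linear factors: arbitrary finite variable types

Topic `Literature/NumberTheory/Transcendental`. Part of the formalisation of the proof of Roy 2013,
Theorem 1.1 (named fact `roy2013_thm_1_1`, `RoySmallValueEstimates.lean`), seat B. The
Gelfond–Mahler inequality `∑_j e_j h_K(c_j) ≤ [K:ℚ] log L(F₀)` of
`RoySmallValueLinearFactors.lean` (`sum_mul_logHeight_le`) is stated for variables indexed by a
linearly ordered finite type (Gauss's lemma there chooses a monomial order). This file transports it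
to an arbitrary non-empty finite index type `ι` (the coefficient variables `(r_μ)_{|μ| = D}` of a
ternary form of degree `D` used in §6 are indexed by a subtype of `ℕ³` without a distinguished linear
order), by renaming the variables along `ι ≃ Fin N`: heights of coefficient vectors, the factorisation
into linear forms and the `ℓ¹`-norm of the coefficients are all invariant under renaming.

* `sum_abs_coeff_rename` — `L(rename e F₀) = L(F₀)`;
* `sum_mul_logHeight_le'` — the inequality for any `[Fintype ι] [Nonempty ι]`.

Everything is proved; no definitions, no named facts.

## References

* [Roy2013] D. Roy, *A small value estimate for 𝔾ₐ × 𝔾ₘ*, Mathematika 59 (2013), 333–363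
  (arXiv:1301.0663), Prop. 2.2 (ii), Prop. 6.4 (the height estimates this replaces).
-/

noncomputable section

open MvPolynomial NumberField Height Finset

namespace Literature.NumberTheory.Transcendental

namespace Roy2013

variable {K : Type*} [Field K] [NumberField K] {ι : Type*} [Fintype ι] {J : Type*} [Fintype J]

omit [NumberField K] [Fintype ι] [Fintype J] in
/-- Renaming the variables along an equivalence does not change `L(F₀) = ∑ |coefficients|`.
[folklore] -/
theorem sum_abs_coeff_rename {N : ℕ} (e : ι ≃ Fin N) (F₀ : MvPolynomial ι ℤ) :
    ∑ m ∈ (rename e F₀).support, |((coeff m (rename e F₀) : ℤ) : ℝ)| =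
      ∑ m ∈ F₀.support, |((coeff m F₀ : ℤ) : ℝ)| := by
  classical
  rw [support_rename_of_injective e.injective, Finset.sum_image fun x _ y _ h =>
    Finsupp.mapDomain_injective e.injective h]
  refine Finset.sum_congr rfl fun m _ => ?_
  rw [coeff_rename_mapDomain e e.injective]

/-- **Gelfond–Mahler inequality for the linear factors of an integer polynomial**, for variables
indexed by any non-empty finite type: if `F₀ ∈ ℤ[X_i : i ∈ ι] ∖ {0}` factors over the number
field `K` as `a ∏_j ℓ_j^{e_j}`, `ℓ_j = ∑_i c_{ji} X_i`, `c_j ≠ 0`, then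
`∑_j e_j h_K(c_j) ≤ [K:ℚ] log L(F₀)`. [cite: Roy2013, Prop. 2.2 (ii) and Prop. 6.4 — replaced] -/
theorem sum_mul_logHeight_le' [Nonempty ι] {F₀ : MvPolynomial ι ℤ} (hF₀ : F₀ ≠ 0)
    {a : K} {c : J → ι → K} (hc : ∀ j, c j ≠ 0) {e : J → ℕ}
    (hfac : map (Int.castRingHom K) F₀ = C a * ∏ j, (∑ i, C (c j i) * X i) ^ e j) :
    ∑ j, (e j : ℝ) * logHeight (c j) ≤
      Module.finrank ℚ K * Real.log (∑ m ∈ F₀.support, |((coeff m F₀ : ℤ) : ℝ)|) := by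
  classical
  set N := Fintype.card ι
  set eq : ι ≃ Fin N := Fintype.equivFin ι with heq
  haveI : Nonempty (Fin N) := ⟨eq (Classical.arbitrary ι)⟩
  -- the renamed data
  set F₁ : MvPolynomial (Fin N) ℤ := rename eq F₀ with hF₁
  have hF₁0 : F₁ ≠ 0 := fun h => hF₀ (rename_injective _ eq.injective (by
    change rename eq F₀ = rename eq 0
    rw [map_zero]; exact h))
  set c₁ : J → Fin N → K := fun j k => c j (eq.symm k) with hc₁def
  have hc₁ : ∀ j, c₁ j ≠ 0 := fun j h => hc j (by
    funext i
    have := congr_fun h (eq i)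
    simpa [hc₁def] using this)
  have hfac₁ : map (Int.castRingHom K) F₁ = C a * ∏ j, (∑ k, C (c₁ j k) * X k) ^ e j := by
    rw [hF₁, map_rename, hfac, map_mul, rename_C, map_prod]
    congr 1
    refine Finset.prod_congr rfl fun j _ => ?_
    rw [map_pow, map_sum]
    congr 1
    rw [← Fintype.sum_equiv eq.symm (fun k => C (c₁ j k) * X k) (fun i => rename eq (C (c j i) * X i))
      (fun k => by rw [map_mul, rename_C, rename_X, hc₁def, Equiv.apply_symm_apply])]
  have h := sum_mul_logHeight_le hF₁0 hc₁ hfac₁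
  have hL : ∑ m ∈ F₁.support, |((coeff m F₁ : ℤ) : ℝ)| = ∑ m ∈ F₀.support, |((coeff m F₀ : ℤ) : ℝ)| :=
    sum_abs_coeff_rename eq F₀
  have hh : ∀ j, logHeight (c₁ j) = logHeight (c j) := fun j => by
    rw [show c₁ j = c j ∘ eq.symm from rfl, logHeight_comp_equiv]
  simp_rw [hh] at h
  rwa [hL] at h

end Roy2013

end Literature.NumberTheory.Transcendental
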